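import Mathlib
import Literature.NumberTheory.LFunctions.Zhang2022.Section16Eval1617
import Literature.NumberTheory.LFunctions.Zhang2022.Section16Endgame
import Literature.NumberTheory.LFunctions.Zhang2022.Section16ResidueLimits
import Literature.NumberTheory.LFunctions.Zhang2022.Section16ResidueValues
import Literature.NumberTheory.LFunctions.Zhang2022.Section16RhoTwoPrep
import Literature.NumberTheory.LFunctions.Zhang2022.Section8Lemma82Steps
import Literature.NumberTheory.LFunctions.Zhang2022.Section16RhoTwoBook
import HarnessLib

/-!
# Zhang (2022), §16 p. 95: "`𝓡₂ⱼ = −1/(β₁L′(1,χ)) + O(𝓛⁶)`, `j = 1, 2`" — the residues of (16.11)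
# at `s = −β₁, −β₂` evaluated under (A), kernel-checked

Topic `Literature/NumberTheory/LFunctions/Zhang2022` (Landau–Siegel audit tree; verdict-neutral).
Y. Zhang, *Discrete mean estimates and the Landau–Siegel zero*, arXiv:2211.02515v1 (2022)
[Zhang2022LandauSiegel] — **an unrefereed manuscript under adjudication**. §16 p. 95 (tex L4674–L4677,
DAG `Z22:§16.u043`, second half): "by Lemma 5.8 and direct calculation, …
`𝓡₂ⱼ = −1/(β₁L′(1,χ)) + O(𝓛⁶)`, `j = 1, 2`", `𝓡₂ⱼ` = the residue of (16.11) at `s = −β_j`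
(`Typed.Section16A.calR2 c′ χ j`, a `limUnder`). PROVED here in the skeleton's vocabulary
(`rho2_estimate`): the sizes of `β₁ = iα(1−5c′α𝓛)`, `β₂ = 2iα(1+c′α𝓛)`, `β₂−β₁ = iα(1+7c′α𝓛)`
(`α = π𝓛⁻⁹`), `P₄^{β₂−β₁} = −1 + O(𝓛⁻⁶)`, `ω₁(β₂−β₁) = 1 + O(α²𝓛⁻³⁰)` (`Section16RhoTwoPrep`), the
tree's Lemma 5.8 (`Lemma58.lemma_5_8_of_le`) at `1 − β₁`, `1 − β₂`, Lemma 5.7 (`|L′(1,χ)| ≥ (4e)⁻¹`),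
and `ζ(1+z) = 1/z + O(1)` (Mathlib `tendsto_riemannZeta_sub_one_div`), fed into the cores
`residue_core_one/two` of `Section16ResidueValues` and the closed forms of `Section16ResidueLimits`.
The bound is really `O(𝓛³)`. The transfer to `Typed.Section16B.Step16_u043` (whose other half `𝓡₂*`
needs Lemma 5.4) is `Section16Eval1617Typed`. Nothing else is asserted; nothing about Theorems 1–2.

## References

* Y. Zhang, arXiv:2211.02515v1 (2022), §16 (16.11), p. 95; §5 Lemmas 5.7, 5.8; §2 (2.13).
  [cite: Zhang2022LandauSiegel, §16 p.95]
-/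

noncomputable section

open Complex Real Filter Topology

namespace Literature.NumberTheory.LFunctions.Zhang2022.Skeleton

/-! ## The assembly: `𝓡₂ⱼ = −1/(β₁L′(1,χ)) + O(𝓛⁶)` under (A) -/

section Assembly

/-- **`ζ(1+z) = 1/z + O(1)` near `z = 0`** (from Mathlib's `ζ(s) − 1/(s−1) → γ`): there are `r > 0`
and `M ≥ 0` with `|ζ(1+z) − z⁻¹| ≤ M` for `0 < |z| < r`. [folklore] -/
private theorem zeta_near_one' : ∃ r : ℝ, 0 < r ∧ ∃ M : ℝ, 0 ≤ M ∧ ∀ z : ℂ, z ≠ 0 → ‖z‖ < r →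
    ‖riemannZeta (1 + z) - z⁻¹‖ ≤ M := by
  have h := tendsto_riemannZeta_sub_one_div
  have h2 := Metric.tendsto_nhds.mp h 1 one_pos
  rw [eventually_nhdsWithin_iff, Metric.eventually_nhds_iff] at h2
  obtain ⟨r, hr, hball⟩ := h2
  refine ⟨r, hr, ‖(Real.eulerMascheroniConstant : ℂ)‖ + 1, by positivity, fun z hz hzr => ?_⟩
  have hmem : dist (1 + z) (1 : ℂ) < r := by simpa [dist_eq_norm] using hzr
  have hne : (1 + z : ℂ) ∈ ({1}ᶜ : Set ℂ) := by simpa using hz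
  have h3 := hball hmem hne
  rw [dist_eq_norm, add_sub_cancel_left, one_div] at h3
  calc ‖riemannZeta (1 + z) - z⁻¹‖
      = ‖(riemannZeta (1 + z) - z⁻¹ - Real.eulerMascheroniConstant) +
          (Real.eulerMascheroniConstant : ℂ)‖ := by ring_nf
    _ ≤ ‖riemannZeta (1 + z) - z⁻¹ - Real.eulerMascheroniConstant‖ +
          ‖(Real.eulerMascheroniConstant : ℂ)‖ := norm_add_le _ _
    _ ≤ 1 + ‖(Real.eulerMascheroniConstant : ℂ)‖ := by gcongr
    _ = _ := by ring


section Final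

variable (c' : ℝ) {D : ℕ} [NeZero D] (χ : DirichletCharacter ℂ D)

/-- **Lemma 5.8 of the tree at `1 + z`, `|z| ≤ 3α`** (`α = π𝓛⁻⁹`, so `3α ≤ 10π𝓛⁻⁹`; `𝓛 ≥ 3`):
`|L(1+z,χ) − L′(1,χ)z| ≤ C₅₈𝓛⁻¹⁵`, `C₅₈ = 1 + 1600e^{9/2}π²`, under (A).
[cite: Zhang2022LandauSiegel, §5 Lemma 5.8] -/
theorem lemma58_at_shift (hp : χ.IsPrimitive) (hℓ3 : 3 ≤ ell D) (hA : AssumptionA D χ) {z : ℂ}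
    (hz : ‖z‖ ≤ 3 * alpha D) :
    ‖χ.LFunction (1 + z) - deriv χ.LFunction 1 * z‖ ≤
      (1 + 16 * Real.exp (9 / 2) * π ^ 2 * 10 ^ 2) / ell D ^ 15 := by
  have hℓ0 : 0 < ell D := by linarith
  have hα9 := alpha_mul_ell_pow_nine (D := D) hℓ0
  have hαeq : alpha D = π / ell D ^ 9 := by rw [← hα9]; field_simp
  have hA' : ‖χ.LFunction 1‖ ≤ 1 / Real.log D ^ 2022 := le_of_lt hA
  have hKL : 10 * π ≤ Real.log D ^ 8 := by
    have : (3 : ℝ) ^ 8 ≤ Real.log D ^ 8 := pow_le_pow_left₀ (by norm_num) hℓ3 8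
    linarith [Real.pi_lt_four]
  have hs : ‖(1 + z) - 1‖ ≤ 10 * π / Real.log D ^ 9 := by
    rw [add_sub_cancel_left]
    refine hz.trans ?_
    rw [hαeq, ell, mul_div_assoc']
    gcongr
    linarith
  have h := Lemma58.lemma_5_8_of_le χ hp hℓ3 hA' hKL hs
  rw [add_sub_cancel_left] at h
  exact h

/-- **`𝓡₂₁ = −1/(β₁L′(1,χ)) + O(𝓛⁶)`, pointwise** (the residue at `s = −β₁`, every input explicit;
constant as in `rho2_estimate`). [cite: Zhang2022LandauSiegel, §16 p.95] -/
theorem residue_one_final {M C₅₈ K₃ δ₄ : ℝ} (hℓ1 : 1 ≤ ell D) (hα9 : alpha D * ell D ^ 9 = π)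
    (hα : 0 < alpha D) (hM : 0 ≤ M) (h4M : 4 * M * alpha D ≤ 1 / 2) (hχ1 : χ ≠ 1) (hP4 : 0 < P4 D)
    (hβ1l : alpha D / 2 ≤ ‖beta1 c' D‖) (hβ1u : ‖beta1 c' D‖ ≤ 2 * alpha D)
    (hγl : alpha D / 2 ≤ ‖beta2 c' D - beta1 c' D‖)
    (hν : ‖beta2 c' D - 2 * beta1 c' D‖ ≤ 12 * |c'| * alpha D ^ 2 * ell D)
    (hLlow : 1 / (4 * Real.exp 1) ≤ ‖deriv χ.LFunction 1‖)
    (hz1 : ‖riemannZeta (1 - beta1 c' D) - (-beta1 c' D)⁻¹‖ ≤ M) (hC58 : 0 ≤ C₅₈)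
    (hL1 : ‖χ.LFunction (1 - beta1 c' D) - (-(beta1 c' D * deriv χ.LFunction 1))‖ ≤ C₅₈ / ell D ^ 15)
    (hEs : C₅₈ / ell D ^ 15 ≤ ‖beta1 c' D‖ * ‖deriv χ.LFunction 1‖ / 4) (hK3 : 0 ≤ K₃)
    (hK3ℓ : K₃ * (ell D ^ 6)⁻¹ ≤ 1)
    (hδ3 : ‖((P4 D : ℝ) : ℂ) ^ (beta2 c' D - beta1 c' D) - (-1)‖ ≤ K₃ * (ell D ^ 6)⁻¹)
    (hδ40 : 0 ≤ δ₄) (hδ41 : δ₄ ≤ 1) (hδ4v : δ₄ ≤ (ell D ^ 6)⁻¹)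
    (hδ4 : ‖GaussWeight.omega1 (ell D ^ 30) (beta2 c' D - beta1 c' D) / (beta2 c' D - beta1 c' D) -
      (beta2 c' D - beta1 c' D)⁻¹‖ ≤ δ₄ * ‖(beta2 c' D - beta1 c' D)⁻¹‖) :
    ‖limUnder (𝓝[≠] (-beta1 c' D)) (fun s => (s + beta1 c' D) *
        (riemannZeta (1 + s + beta1 c' D) / (riemannZeta (1 + s) * χ.LFunction (1 + s)) *
          (((P4 D : ℝ) : ℂ) ^ (s + beta2 c' D) * GaussWeight.omega1 (ell D ^ 30) (s + beta2 c' D) /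
            (s + beta2 c' D)))) +
      1 / (beta1 c' D * deriv χ.LFunction 1)‖ ≤
      (512 * Real.exp 1 * M + 1024 * Real.exp 1 ^ 2 * C₅₈ / π ^ 2 + 64 * Real.exp 1 * K₃ / π +
        64 * Real.exp 1 / π + 192 * Real.exp 1 * |c'|) * ell D ^ 6 := by
  set L : ℂ := deriv χ.LFunction 1 with hLdef
  have hL0 : L ≠ 0 := norm_pos_iff.mp (lt_of_lt_of_le (by positivity) hLlow)
  have hβ10 : beta1 c' D ≠ 0 := norm_pos_iff.mp (by linarith)
  have hγ0 : beta2 c' D - beta1 c' D ≠ 0 := norm_pos_iff.mp (by linarith)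
  have hβ12 : beta1 c' D ≠ beta2 c' D := fun h => hγ0 (by rw [h, sub_self])
  obtain ⟨hζ0, hL10, hcore⟩ := residue_core_one (ζ₁ := riemannZeta (1 - beta1 c' D))
    (L₁ := χ.LFunction (1 - beta1 c' D)) (p := ((P4 D : ℝ) : ℂ) ^ (beta2 c' D - beta1 c' D))
    (q := GaussWeight.omega1 (ell D ^ 30) (beta2 c' D - beta1 c' D) / (beta2 c' D - beta1 c' D))
    hα hβ1l hβ1u hγ0 hL0 hM h4M hz1 (by positivity) hEs hL1 (by positivity) hK3ℓ hδ3 hδ40 hδ41 hδ4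
  rw [residue1611_one_eq χ hχ1 hP4 hβ10 hβ12 hζ0 hL10]
  have hshift := main_term_shift hα hβ1l hγl hL0
    (le_of_eq (by rw [show beta2 c' D - beta1 c' D - beta1 c' D = beta2 c' D - 2 * beta1 c' D by ring]) :
      ‖beta2 c' D - beta1 c' D - beta1 c' D‖ ≤ ‖beta2 c' D - 2 * beta1 c' D‖)
  have hLγ : ‖(L * (beta2 c' D - beta1 c' D))⁻¹‖ = (‖L‖ * ‖beta2 c' D - beta1 c' D‖)⁻¹ := by
    rw [norm_inv, norm_mul]
  rw [hLγ] at hcore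
  have hv : (riemannZeta (1 - beta1 c' D) * χ.LFunction (1 - beta1 c' D))⁻¹ *
      (((P4 D : ℝ) : ℂ) ^ (beta2 c' D - beta1 c' D) *
        GaussWeight.omega1 (ell D ^ 30) (beta2 c' D - beta1 c' D) / (beta2 c' D - beta1 c' D)) +
      1 / (beta1 c' D * L) =
    ((riemannZeta (1 - beta1 c' D))⁻¹ * (χ.LFunction (1 - beta1 c' D))⁻¹ *
        ((P4 D : ℝ) : ℂ) ^ (beta2 c' D - beta1 c' D) *
        (GaussWeight.omega1 (ell D ^ 30) (beta2 c' D - beta1 c' D) / (beta2 c' D - beta1 c' D)) -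
      (-(L * (beta2 c' D - beta1 c' D))⁻¹)) +
    (-(L * (beta2 c' D - beta1 c' D))⁻¹ - (-(beta1 c' D * L)⁻¹)) := by
    rw [mul_inv]; ring
  rw [hv]
  refine residue_bookkeeping (nβ := ‖beta1 c' D‖) (nγ := ‖beta2 c' D - beta1 c' D‖)
    (δ₃ := K₃ * (ell D ^ 6)⁻¹) (δ₄ := δ₄) hℓ1 hα9 hM hβ1l hLlow hγl rfl hC58 le_rfl hK3 hδ4v hν
    (abs_nonneg c') ?_
  refine (norm_add_le _ _).trans (add_le_add (hcore.trans ?_) hshift)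
  have hS : 4 * M * alpha D + 2 * (C₅₈ / ell D ^ 15 / (‖beta1 c' D‖ * ‖L‖)) + K₃ * (ell D ^ 6)⁻¹ + δ₄ ≤
      8 * M * alpha D + 2 * (C₅₈ / ell D ^ 15 / (‖beta1 c' D‖ * ‖L‖)) + K₃ * (ell D ^ 6)⁻¹ + δ₄ := by
    nlinarith [mul_nonneg hM hα.le]
  exact mul_le_mul_of_nonneg_right (mul_le_mul_of_nonneg_left hS (by norm_num)) (by positivity)

/-- **`𝓡₂₂ = −1/(β₁L′(1,χ)) + O(𝓛⁶)`, pointwise** (the residue at `s = −β₂`; constant as in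
`rho2_estimate`). [cite: Zhang2022LandauSiegel, §16 p.95] -/
theorem residue_two_final {M C₅₈ K₃ : ℝ} (hℓ1 : 1 ≤ ell D) (hα9 : alpha D * ell D ^ 9 = π)
    (hα : 0 < alpha D) (hM : 0 ≤ M) (h6M : 6 * M * alpha D ≤ 1 / 2) (hχ1 : χ ≠ 1) (hP4 : 0 < P4 D)
    (hβ1l : alpha D / 2 ≤ ‖beta1 c' D‖) (hβ2l : alpha D ≤ ‖beta2 c' D‖)
    (hβ2u : ‖beta2 c' D‖ ≤ 3 * alpha D) (hγl : alpha D / 2 ≤ ‖beta2 c' D - beta1 c' D‖)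
    (hγu : ‖beta2 c' D - beta1 c' D‖ ≤ 2 * alpha D)
    (hν : ‖beta2 c' D - 2 * beta1 c' D‖ ≤ 12 * |c'| * alpha D ^ 2 * ell D)
    (hLlow : 1 / (4 * Real.exp 1) ≤ ‖deriv χ.LFunction 1‖)
    (hz2 : ‖riemannZeta (1 + beta1 c' D - beta2 c' D) - (-(beta2 c' D - beta1 c' D))⁻¹‖ ≤ M)
    (hz3 : ‖riemannZeta (1 - beta2 c' D) - (-beta2 c' D)⁻¹‖ ≤ M) (hC58 : 0 ≤ C₅₈)
    (hL2 : ‖χ.LFunction (1 - beta2 c' D) - (-(beta2 c' D * deriv χ.LFunction 1))‖ ≤ C₅₈ / ell D ^ 15)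
    (hEs : C₅₈ / ell D ^ 15 ≤ ‖beta2 c' D‖ * ‖deriv χ.LFunction 1‖ / 4) (hK3 : 0 ≤ K₃) :
    ‖limUnder (𝓝[≠] (-beta2 c' D)) (fun s => (s + beta2 c' D) *
        (riemannZeta (1 + s + beta1 c' D) / (riemannZeta (1 + s) * χ.LFunction (1 + s)) *
          (((P4 D : ℝ) : ℂ) ^ (s + beta2 c' D) * GaussWeight.omega1 (ell D ^ 30) (s + beta2 c' D) /
            (s + beta2 c' D)))) +
      1 / (beta1 c' D * deriv χ.LFunction 1)‖ ≤
      (512 * Real.exp 1 * M + 1024 * Real.exp 1 ^ 2 * C₅₈ / π ^ 2 + 64 * Real.exp 1 * K₃ / π +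
        64 * Real.exp 1 / π + 192 * Real.exp 1 * |c'|) * ell D ^ 6 := by
  set L : ℂ := deriv χ.LFunction 1 with hLdef
  have hℓ0 : 0 < ell D := by linarith
  have hL0 : L ≠ 0 := norm_pos_iff.mp (lt_of_lt_of_le (by positivity) hLlow)
  have hβ20 : beta2 c' D ≠ 0 := norm_pos_iff.mp (by linarith)
  have hγ0 : beta2 c' D - beta1 c' D ≠ 0 := norm_pos_iff.mp (by linarith)
  have hβ12 : beta1 c' D ≠ beta2 c' D := fun h => hγ0 (by rw [h, sub_self])
  obtain ⟨hζ0, hL20, hcore⟩ := residue_core_two (ζ₂ := riemannZeta (1 + beta1 c' D - beta2 c' D))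
    (ζ₃ := riemannZeta (1 - beta2 c' D)) (L₂ := χ.LFunction (1 - beta2 c' D))
    hα hβ2l hβ2u hγ0 hγu hL0 hM h6M hz2 hz3 (by positivity) hEs hL2
  rw [residue1611_two_eq χ hχ1 hP4 hβ20 hβ12 hζ0 hL20]
  have hshift := main_term_shift hα hβ1l hγl hL0
    (le_of_eq (by rw [show beta2 c' D - beta1 c' D - beta1 c' D = beta2 c' D - 2 * beta1 c' D by ring]) :
      ‖beta2 c' D - beta1 c' D - beta1 c' D‖ ≤ ‖beta2 c' D - 2 * beta1 c' D‖)
  have hLγ : ‖(L * (beta2 c' D - beta1 c' D))⁻¹‖ = (‖L‖ * ‖beta2 c' D - beta1 c' D‖)⁻¹ := by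
    rw [norm_inv, norm_mul]
  rw [hLγ] at hcore
  have hv : riemannZeta (1 + beta1 c' D - beta2 c' D) /
        (riemannZeta (1 - beta2 c' D) * χ.LFunction (1 - beta2 c' D)) + 1 / (beta1 c' D * L) =
    (riemannZeta (1 + beta1 c' D - beta2 c' D) * (riemannZeta (1 - beta2 c' D))⁻¹ *
        (χ.LFunction (1 - beta2 c' D))⁻¹ - (-(L * (beta2 c' D - beta1 c' D))⁻¹)) +
    (-(L * (beta2 c' D - beta1 c' D))⁻¹ - (-(beta1 c' D * L)⁻¹)) := by
    rw [div_eq_mul_inv, mul_inv]; ring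
  rw [hv]
  have h60 : (0 : ℝ) ≤ (ell D ^ 6)⁻¹ := by positivity
  refine residue_bookkeeping (nβ := ‖beta2 c' D‖) (nγ := ‖beta2 c' D - beta1 c' D‖) (δ₃ := 0)
    (δ₄ := 0) hℓ1 hα9 hM (by linarith) hLlow hγl rfl hC58 (by positivity) hK3 h60
    hν (abs_nonneg c') ?_
  refine (norm_add_le _ _).trans (add_le_add (hcore.trans (le_of_eq ?_)) hshift)
  ring

/-- **§16 p. 95: "`𝓡₂ⱼ = −1/(β₁L′(1,χ)) + O(𝓛⁶)`, `j = 1, 2`"** (tex L4675, DAG `Z22:§16.u043`,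
second half; `𝓡₂ⱼ = lim_{s→−β_j}(s+β_j)·(16.11)(s)` as typed in `Typed.Section16A.calR2`), PROVED
under (A) for all large `D`; `O`-constant `512eM + 1024e²C₅₈/π² + 64eK₃/π + 64e/π + 192e|c′|`
(`M` bounds `|ζ(1+z) − 1/z|` near `0`, `C₅₈ = 1 + 1600e^{9/2}π²`, `K₃ = 521π + 3654π²|c′|`).
[cite: Zhang2022LandauSiegel, §16 p.95] -/
theorem rho2_estimate : ∃ C : ℝ, ForAllLarge fun D _ χ => AssumptionA D χ →
    ∀ j ∈ ({1, 2} : Finset ℕ),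
      ‖limUnder (𝓝[≠] (-betaJ c' D j)) (fun s => (s + betaJ c' D j) *
          (riemannZeta (1 + s + beta1 c' D) / (riemannZeta (1 + s) * χ.LFunction (1 + s)) *
            (((P4 D : ℝ) : ℂ) ^ (s + beta2 c' D) * GaussWeight.omega1 (ell D ^ 30) (s + beta2 c' D) /
              (s + beta2 c' D)))) +
        1 / (beta1 c' D * deriv χ.LFunction 1)‖ ≤ C * ell D ^ 6 := by
  obtain ⟨r, hr, M, hM, hζ⟩ := zeta_near_one'
  set C58 : ℝ := 1 + 16 * Real.exp (9 / 2) * π ^ 2 * 10 ^ 2 with hC58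
  have hC58pos : 0 ≤ C58 := by positivity
  set K3 : ℝ := 521 * π + 3654 * π ^ 2 * |c'| with hK3
  have hK3pos : 0 ≤ K3 := by positivity
  obtain ⟨Dl, hDl⟩ := self_div_totient_le_norm_deriv_L_one
  obtain ⟨D₂, h₂⟩ := exists_forall_le_ell (max (max 3 (14 * π * |c'| + 1))
    (max (max (3 * π / r + 1) (12 * M * π + 1)) (max (32 * Real.exp 1 * C58 / π + 1) (K3 + 1))))
  refine ⟨512 * Real.exp 1 * M + 1024 * Real.exp 1 ^ 2 * C58 / π ^ 2 + 64 * Real.exp 1 * K3 / π +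
    64 * Real.exp 1 / π + 192 * Real.exp 1 * |c'|, max D₂ Dl, fun D _ χ hD hq hp hA j hj => ?_⟩
  -- thresholds on `𝓛`
  have hT := h₂ D (le_trans (le_max_left _ _) hD)
  have hℓ3 : 3 ≤ ell D := le_trans (le_trans (le_max_left _ _) (le_max_left _ _)) hT
  have hℓc : 14 * π * |c'| + 1 ≤ ell D := le_trans (le_trans (le_max_right _ _) (le_max_left _ _)) hT
  have hℓr : 3 * π / r + 1 ≤ ell D :=
    le_trans (le_trans (le_trans (le_max_left _ _) (le_max_left _ _)) (le_max_right _ _)) hT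
  have hℓM : 12 * M * π + 1 ≤ ell D :=
    le_trans (le_trans (le_trans (le_max_right _ _) (le_max_left _ _)) (le_max_right _ _)) hT
  have hℓE : 32 * Real.exp 1 * C58 / π + 1 ≤ ell D :=
    le_trans (le_trans (le_trans (le_max_left _ _) (le_max_right _ _)) (le_max_right _ _)) hT
  have hℓK : K3 + 1 ≤ ell D :=
    le_trans (le_trans (le_trans (le_max_right _ _) (le_max_right _ _)) (le_max_right _ _)) hT
  have hℓ1 : 1 ≤ ell D := by linarith
  have hℓ0 : 0 < ell D := by linarith
  have hα9 : alpha D * ell D ^ 9 = π := alpha_mul_ell_pow_nine hℓ0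
  have hα : 0 < alpha D := alpha_pos_of_ell_pos hℓ0
  obtain ⟨hc14, h5⟩ := c_alpha_ell_small c' hℓ1 hℓc
  obtain ⟨hβ1l, hβ1u⟩ := norm_beta1_bounds c' hα.le (by positivity) h5
  obtain ⟨hβ2l, hβ2u, hγl, hγu, hν⟩ := beta_sizes c' hα.le (by positivity) hc14
  obtain ⟨h3αr, h6M, h4M⟩ := alpha_small_rM (D := D) hr hM hℓ1 hℓr hℓM
  have hβ10 : beta1 c' D ≠ 0 := norm_pos_iff.mp (by linarith)
  have hβ20 : beta2 c' D ≠ 0 := norm_pos_iff.mp (by linarith)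
  have hγ0 : beta2 c' D - beta1 c' D ≠ 0 := norm_pos_iff.mp (by linarith)
  have hD3 : 3 ≤ D := Section8Lemma82Steps.three_le_of_ell hℓ3
  have hχ1 : χ ≠ 1 := ne_one_of_isPrimitive_of_three_le hp hD3
  have hLge := hDl D χ (le_trans (le_max_right _ _) hD) hq hp hA
  have hφ1 : 1 ≤ (D : ℝ) / Nat.totient D := by
    rw [le_div_iff₀ (by exact_mod_cast Nat.totient_pos.mpr (by omega)), one_mul]
    exact_mod_cast Nat.totient_le D
  have hLlow : 1 / (4 * Real.exp 1) ≤ ‖deriv χ.LFunction 1‖ := by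
    rw [div_le_iff₀ (by positivity)]; linarith [hLge, hφ1]
  have hP4 : 0 < P4 D := P4_pos hℓ0
  have hδ3 := norm_P4_cpow_add_one_le c' (D := D) hℓ1
  have hK3ℓ : K3 * (ell D ^ 6)⁻¹ ≤ 1 := by
    rw [← div_eq_mul_inv, div_le_one (by positivity)]
    linarith [le_self_pow₀ hℓ1 (by norm_num : (6 : ℕ) ≠ 0)]
  obtain ⟨-, h21, -⟩ := beta2_eq_I_mul c' D
  have hδ4 := norm_omega1_div_sub_inv_le (Λ := ell D ^ 30)
    (b := alpha D * (1 + 7 * c' * alpha D * ell D)) (by positivity)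
  rw [← h21] at hδ4
  obtain ⟨hδ4v, hδ4one⟩ := weight_error_small (D := D) hℓ3 hγu (norm_nonneg _)
  simp only [Finset.mem_insert, Finset.mem_singleton] at hj
  rcases hj with rfl | rfl
  · have hb1 : betaJ c' D 1 = beta1 c' D := by simp [betaJ]
    rw [hb1]
    have hz1 : ‖riemannZeta (1 - beta1 c' D) - (-beta1 c' D)⁻¹‖ ≤ M := by
      have := hζ (-beta1 c' D) (neg_ne_zero.mpr hβ10) (by rw [norm_neg]; linarith)
      rwa [← sub_eq_add_neg] at this
    have hL1 : ‖χ.LFunction (1 - beta1 c' D) - (-(beta1 c' D * deriv χ.LFunction 1))‖ ≤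
        C58 / ell D ^ 15 := by
      have := lemma58_at_shift χ hp hℓ3 hA (z := -beta1 c' D) (by rw [norm_neg]; linarith)
      rwa [← sub_eq_add_neg, show deriv χ.LFunction 1 * -beta1 c' D =
        -(beta1 c' D * deriv χ.LFunction 1) by ring] at this
    exact residue_one_final c' χ hℓ1 hα9 hα hM h4M hχ1 hP4 hβ1l hβ1u hγl hν hLlow hz1 hC58pos hL1
      (lemma58_error_small hℓ1 hℓE hβ1l hLlow) hK3pos hK3ℓ hδ3 (by positivity) hδ4one hδ4v
      hδ4
  · have hb2' : betaJ c' D 2 = beta2 c' D := by simp [betaJ]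
    rw [hb2']
    have hz2 : ‖riemannZeta (1 + beta1 c' D - beta2 c' D) - (-(beta2 c' D - beta1 c' D))⁻¹‖ ≤ M := by
      have := hζ (-(beta2 c' D - beta1 c' D)) (neg_ne_zero.mpr hγ0) (by rw [norm_neg]; linarith)
      rwa [show (1 : ℂ) + -(beta2 c' D - beta1 c' D) = 1 + beta1 c' D - beta2 c' D by ring] at this
    have hz3 : ‖riemannZeta (1 - beta2 c' D) - (-beta2 c' D)⁻¹‖ ≤ M := by
      have := hζ (-beta2 c' D) (neg_ne_zero.mpr hβ20) (by rw [norm_neg]; linarith)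
      rwa [← sub_eq_add_neg] at this
    have hL2 : ‖χ.LFunction (1 - beta2 c' D) - (-(beta2 c' D * deriv χ.LFunction 1))‖ ≤
        C58 / ell D ^ 15 := by
      have := lemma58_at_shift χ hp hℓ3 hA (z := -beta2 c' D) (by rw [norm_neg]; linarith)
      rwa [← sub_eq_add_neg, show deriv χ.LFunction 1 * -beta2 c' D =
        -(beta2 c' D * deriv χ.LFunction 1) by ring] at this
    exact residue_two_final c' χ hℓ1 hα9 hα hM h6M hχ1 hP4 hβ1l hβ2l hβ2u hγl hγu hν hLlow hz2 hz3
      hC58pos hL2 (lemma58_error_small hℓ1 hℓE (by linarith) hLlow) hK3pos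

end Final

end Assembly

end Literature.NumberTheory.LFunctions.Zhang2022.Skeleton
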